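import Literature.NumberTheory.Automorphic.ShimuraCurveRibetTakahashiPairwiseEisensteinProofs
import HarnessLib

/-!
# Stub-ideation k1 · gen 35 — `W0`: the two-tier Brandt character-group dictionary

`W0` = the `hDict` section hypothesis of
`Literature/NumberTheory/Automorphic/ShimuraCurveRibetTakahashiPairwiseEisensteinProofs.lean`
with its three ANY-DATUM conjuncts (adjunction, `π_* π^* = deg`, Hecke membership of `π^* 1`)
pulled out from under the optimality premise `hmin`; the four optimal-datum conjuncts
(surjectivity of `π_*`, saturation of `X`, degree-zero vectors in `X`, rank one) stay guarded by `hmin`.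
Consumers certified below: g34's `W1 = WeakCharGroupDictionary` (projection) and the named fact
`takahashi2001_thm_2_3_of_coprime` (via the EXISTING `takahashi2001_thm_2_3_of_coprime_of_brandtDictionary`).
[cite: Takahashi2001, Prop. 1.1, Thm. 2.3, pp. 78–80, 84] [cite: Ribet1990, §3] [cite: ConradStein2001, §2.1]
SGA 7 IX (Grothendieck: functoriality/adjointness of the monodromy pairing under a morphism and its dual).
-/

namespace Summit.ABC.ABC.Cruxes.SteinbergCore.StubIdeasK1G35

open Literature.NumberTheory.EllipticCurves Literature.NumberTheory.EllipticCurves.ModularForms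
  Literature.NumberTheory.Automorphic

/-- **W1** — VERBATIM copy of g34's `StubIdeasK1G34.WeakCharGroupDictionary`
(`Cruxes/SteinbergCore/STUB_IDEAS_stub_xiDegreeComparison_1_g34_Sketch.lean`, unbuilt on the farm today:
`remote:stale:unbuilt`), restated here only so that the projection `W0 ⇒ W1` is kernel-checked against the
same text. [cite: Ribet1990, §3 (3.1)–(3.3)] [cite: Takahashi2001, Prop. 1.1 (p. 80)] [cite: ConradStein2001, §2.1] -/
def WeakCharGroupDictionary : Prop :=
  ∀ (W : WeierstrassCurve ℚ) [W.IsElliptic] (M r : ℕ) [NeZero (M * r)],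
    r.Prime → M.Coprime r → W.conductorNorm ℤ = M * r →
    ∀ (P : ModularParametrizationData W (M * r))
      (S : Brandt.XiSetup M r) [Fintype (Brandt.ClassSet S.O)],
      ∃ (X : Submodule ℤ (Brandt.ClassSet S.O → ℤ)) (pb : ℤ →ₗ[ℤ] X) (pf : X →ₗ[ℤ] ℤ),
        (∀ (a : ℤ) (y : X),
            ∑ i, (Brandt.weight S.O i : ℤ) * (pb a : Brandt.ClassSet S.O → ℤ) i *
                (y : Brandt.ClassSet S.O → ℤ) i =
              ((W.minimalDiscriminantNorm ℤ).factorization r : ℤ) * a * pf y) ∧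
        (∀ a : ℤ, pf (pb a) = (P.deg : ℤ) * a) ∧
        (pb 1 : Brandt.ClassSet S.O → ℤ) ∈
          Brandt.eigenLattice (M * r) (Brandt.matrix S.O) (fun n => W.LFunction n)

/-- **W0** (two-tier character-group dictionary at a prime `r ∥ N`, `N = M r`, `gcd(M,r)=1`, `D = 1`).
Tier 1 holds for EVERY modular parametrisation datum `P` of `W` (no optimality, no multiplicity one):
`π^* : X_r(W) = ℤ → X := X_r(J₀(Mr)) ⊆ ℤ^{Cls O}`, `π_* : X → ℤ`, adjoint for the monodromy pairings
(`u_W = c_r(W)·xy`, `c_r(W) = ord_r Δ_min(W)`; Brandt pairing `Σ w_i x_i y_i` on `X`), `π_* π^* = deg P`,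
`π^* 1` a `T_p`-eigenvector (`p ∤ Mr`) with eigenvalues `a_p(W)`.  Tier 2 = the tree's `hDict` extras,
only for the minimal (= optimal) datum. -/
def BrandtCharGroupDictionary : Prop :=
  ∀ (W : WeierstrassCurve ℚ) [W.IsElliptic] (M r : ℕ) [NeZero (M * r)],
    r.Prime → M.Coprime r → W.conductorNorm ℤ = M * r →
    ∀ (P : ModularParametrizationData W (M * r))
      (S : Brandt.XiSetup M r) [Fintype (Brandt.ClassSet S.O)],
      ∃ (X : Submodule ℤ (Brandt.ClassSet S.O → ℤ)) (pb : ℤ →ₗ[ℤ] X) (pf : X →ₗ[ℤ] ℤ),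
        (∀ (a : ℤ) (y : X),
            ∑ i, (Brandt.weight S.O i : ℤ) * (pb a : Brandt.ClassSet S.O → ℤ) i *
                (y : Brandt.ClassSet S.O → ℤ) i =
              ((W.minimalDiscriminantNorm ℤ).factorization r : ℤ) * a * pf y) ∧
        (∀ a : ℤ, pf (pb a) = (P.modularDegree : ℤ) * a) ∧
        (pb 1 : Brandt.ClassSet S.O → ℤ) ∈
          Brandt.eigenLattice (M * r) (Brandt.matrix S.O) (fun n => W.LFunction n) ∧
        ((∀ (W' : WeierstrassCurve ℚ) [W'.IsElliptic], W'.conductorNorm ℤ = M * r →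
            ∀ P' : ModularParametrizationData W' (M * r),
              P'.f = P.f → P.modularDegree ≤ P'.modularDegree) →
          Function.Surjective pf ∧
          (∀ (m : ℤ) (v : Brandt.ClassSet S.O → ℤ), m ≠ 0 → m • v ∈ X → v ∈ X) ∧
          (∀ v : Brandt.ClassSet S.O → ℤ, ∑ i, v i = 0 → v ∈ X) ∧
          Module.finrank ℤ
              (Brandt.eigenLattice (M * r) (Brandt.matrix S.O) (fun n => W.LFunction n)) = 1)

/-- `W0 ⇒ W1` (g34's `WeakCharGroupDictionary`, stated with `P.deg`; `P.modularDegree := P.deg`):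
projection onto tier 1. -/
theorem weakCharGroupDictionary_of_dictionary (h : BrandtCharGroupDictionary) :
    WeakCharGroupDictionary := by
  intro W _ M r _ hr hMr hN P S _
  obtain ⟨X, pb, pf, h1, h2, h5, -⟩ := h W M r hr hMr hN P S
  exact ⟨X, pb, pf, h1, h2, h5⟩

/-- `W0 ⇒ takahashi2001_thm_2_3_of_coprime` (the named fact `hT1` of p137891 /
`DefiniteRTControlPrime…_of_facts`) through the EXISTING tree theorem
`takahashi2001_thm_2_3_of_coprime_of_brandtDictionary`: reassemble `hDict` from the two tiers. -/
theorem takahashi2001_thm_2_3_of_coprime_of_dictionary (h : BrandtCharGroupDictionary) :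
    takahashi2001_thm_2_3_of_coprime :=
  takahashi2001_thm_2_3_of_coprime_of_brandtDictionary
    (fun W _ M r _ hr hMr hN P hmin S _ => by
      obtain ⟨X, pb, pf, h1, h2, h5, hopt⟩ := h W M r hr hMr hN P S
      obtain ⟨h3, h4, h6, h7⟩ := hopt hmin
      exact ⟨X, pb, pf, h1, h2, h3, h4, h6, h7, h5⟩)

end Summit.ABC.ABC.Cruxes.SteinbergCore.StubIdeasK1G35
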